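import Literature.Probability.FitznerVanDerHofstad2017.SawCountD11Link
import Literature.Probability.FitznerVanDerHofstad2017.SawCountTablesGN12X1111y
import Literature.Probability.FitznerVanDerHofstad2017.SawCountTablesGN12X112w
import Literature.Probability.FitznerVanDerHofstad2017.TrailCountTablesD11V2
import Literature.Probability.FitznerVanDerHofstad2017.PosExprEval
import Literature.Probability.FitznerVanDerHofstad2017.Stage1CellsU
import Literature.Probability.FitznerVanDerHofstad2017.MeanFieldD11Stage1Tabs13
import HarnessLib
import Summits.CriticalPhenomena.LaceExpansionHighD.SawReadKeysA

/-!
# Walk-count read keys of the record `d = 11` stage-1 evaluation — PART B (generic half)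

`PXKeys.allTabs` (the table keys read by a positive expression all pass a Boolean test; primitive-recursor form for
`decide +kernel`), the congruence lemmas `PXKeys.evalQ_congr` / `eval_congr`, the relative monotonicity lemma
`PXKeys.eval_mono_tabs_on`, the read test `sawKeyRead`, and the `AtP*` / `vecL` / `matL` glue used by the cell lists.
See the module docstring of `SawReadKeysA` for the whole statement.  LAYOUT (enum1-g12, four modules of `≤ 390` lines, bodies verbatim from enum1-g11 rev 3, chained by sibling imports):
`SawReadKeysA` (PART A) → `SawReadKeysPX` (PART B, generic `PXKeys` lemmas + glue) → `SawReadKeysCells` (PART B, the generated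
cell lists `cellsAt`) → `SawReadKeys` (PART B census + headline, PART C).
-/

namespace Summit.CriticalPhenomena.LaceExpansionHighD

open Literature.Probability.FitznerVanDerHofstad2017 Literature.Probability.Percolation
open Literature.Probability.FitznerVanDerHofstad2017.Stage1Cells (V)

/-! ## Part B — the TYPED stage-1 cells read `nrSAW` only on the read set

A syntactic census, decided by the kernel: every table key `.saw j v` occurring in any closed cell of the notebook port
`Stage1Cells`, of the record variant `Stage1Cells.Rec` and of its `U`-column `Stage1Cells.Rec.U` — scalar cells, the
entries of vector / matrix cells, and the four parametrised cells the frame consumes directly (`openBubble P 1 0`,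
`G1 P 1`, `G2 P 2`, `G01 P 2`) — at the record parameters `CertD11.P = (11, 12, 28)` and `CertD11CS13.P13 = (11, 13, 28)`,
lies in `sawReadKeys13` (ranged sums `sumR lo hi f` inspected on `j = lo, …, hi`, the values `PX.eval` uses; the
remainder-slotted family `Stage1Cells.Rem` at the record slots is the port itself, `Rem.X_print … = rfl`).  With the
congruence lemma `PXKeys.evalQ_congr` this gives the consumer statement: replacing the `nrSAW` column of the record
tables by the TRUE endpoint counts — at every key, certified or not, tabulated or not — changes the value of no cell. -/

namespace PXKeys

variable {ι κ : Type}

/-- `allTabs r e`: every table key READ by the positive expression `e` satisfies the Boolean test `r`; a ranged sum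
`sumR lo hi f` is inspected exactly on its summation range `j = lo, …, hi` (the only values `eval` uses).  Written with
the primitive recursor (like `PX.evalQ`) so that `decide +kernel` evaluates it on a closed stage-1 cell. -/
noncomputable def allTabs (r : κ → Bool) (e : PX ι κ) : Bool :=
  @PX.rec ι κ (fun _ => Bool) (fun _ => true) r (fun _ => true) (fun _ _ ra rb => ra && rb) (fun _ _ ra rb => ra && rb)
    (fun _ _ ra => ra) (fun _ _ ra rb => ra && rb) (fun _ _ ra rb => ra && rb) (fun _ _ ra => ra) (fun _ _ ra => ra)
    (fun lo hi _ ih => (List.range' lo (hi + 1 - lo)).all ih) e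

section Eqns
variable (r : κ → Bool)
/-- `allTabs` on `atom`. -/
@[simp] theorem allTabs_atom (i : ι) : allTabs r (PX.atom i : PX ι κ) = true := rfl
/-- `allTabs` on `tab`. -/
@[simp] theorem allTabs_tab (k : κ) : allTabs r (PX.tab k : PX ι κ) = r k := rfl
/-- `allTabs` on `num`. -/
@[simp] theorem allTabs_num (n : ℕ) : allTabs r (PX.num n : PX ι κ) = true := rfl
/-- `allTabs` on `add`. -/
@[simp] theorem allTabs_add (a b : PX ι κ) : allTabs r (PX.add a b) = (allTabs r a && allTabs r b) := rfl
/-- `allTabs` on `mul`. -/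
@[simp] theorem allTabs_mul (a b : PX ι κ) : allTabs r (PX.mul a b) = (allTabs r a && allTabs r b) := rfl
/-- `allTabs` on `divN`. -/
@[simp] theorem allTabs_divN (a : PX ι κ) (n : ℕ) : allTabs r (PX.divN a n) = allTabs r a := rfl
/-- `allTabs` on `emax`. -/
@[simp] theorem allTabs_emax (a b : PX ι κ) : allTabs r (PX.emax a b) = (allTabs r a && allTabs r b) := rfl
/-- `allTabs` on `emin`. -/
@[simp] theorem allTabs_emin (a b : PX ι κ) : allTabs r (PX.emin a b) = (allTabs r a && allTabs r b) := rfl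
/-- `allTabs` on `pow`. -/
@[simp] theorem allTabs_pow (a : PX ι κ) (n : ℕ) : allTabs r (PX.pow a n) = allTabs r a := rfl
/-- `allTabs` on `oddComp`. -/
@[simp] theorem allTabs_oddComp (a : PX ι κ) (n : ℕ) : allTabs r (PX.oddComp a n) = allTabs r a := rfl
/-- `allTabs` on `sumR`. -/
@[simp] theorem allTabs_sumR (lo hi : ℕ) (f : ℕ → PX ι κ) :
    allTabs r (PX.sumR lo hi f) = (List.range' lo (hi + 1 - lo)).all (fun j => allTabs r (f j)) := rfl
end Eqns

/-- keys in the summation range of `sumR lo hi` are inspected. -/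
theorem mem_range'_of_mem_Icc {lo hi j : ℕ} (hj : j ∈ Finset.Icc lo hi) : j ∈ List.range' lo (hi + 1 - lo) := by
  rw [Finset.mem_Icc] at hj; rw [List.mem_range'_1]; omega

/-- CONGRUENCE IN THE TABLES (rational semantics): two table valuations that agree on every key read by `e` give it
the same value. -/
theorem evalQ_congr {r : κ → Bool} {va : ι → ℚ} {vt vt' : κ → ℚ} (h : ∀ k, r k = true → vt k = vt' k) :
    ∀ e : PX ι κ, allTabs r e = true → PX.evalQ va vt e = PX.evalQ va vt' e
  | .atom _, _ => rfl
  | .tab k, he => h k he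
  | .num _, _ => rfl
  | .add a b, he => by
      simp only [allTabs_add, Bool.and_eq_true] at he
      simp only [PX.evalQ_add', evalQ_congr h a he.1, evalQ_congr h b he.2]
  | .mul a b, he => by
      simp only [allTabs_mul, Bool.and_eq_true] at he
      simp only [PX.evalQ_mul', evalQ_congr h a he.1, evalQ_congr h b he.2]
  | .divN a n, he => by simp only [PX.evalQ_divN, evalQ_congr h a he]
  | .emax a b, he => by
      simp only [allTabs_emax, Bool.and_eq_true] at he
      simp only [PX.evalQ_emax, evalQ_congr h a he.1, evalQ_congr h b he.2]
  | .emin a b, he => by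
      simp only [allTabs_emin, Bool.and_eq_true] at he
      simp only [PX.evalQ_emin, evalQ_congr h a he.1, evalQ_congr h b he.2]
  | .pow a n, he => by simp only [PX.evalQ_pow', evalQ_congr h a he]
  | .oddComp a n, he => by simp only [PX.evalQ_oddComp, evalQ_congr h a he]
  | .sumR lo hi f, he => by
      rw [allTabs_sumR, List.all_eq_true] at he
      simp only [PX.evalQ_sumR]
      exact Finset.sum_congr rfl fun j hj => evalQ_congr h (f j) (he j (mem_range'_of_mem_Icc hj))

/-- CONGRUENCE IN THE TABLES (real semantics). -/
theorem eval_congr {r : κ → Bool} {va : ι → ℝ} {vt vt' : κ → ℝ} (h : ∀ k, r k = true → vt k = vt' k) :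
    ∀ e : PX ι κ, allTabs r e = true → PX.eval va vt e = PX.eval va vt' e
  | .atom _, _ => rfl
  | .tab k, he => h k he
  | .num _, _ => rfl
  | .add a b, he => by
      simp only [allTabs_add, Bool.and_eq_true] at he
      simp only [PX.eval, eval_congr h a he.1, eval_congr h b he.2]
  | .mul a b, he => by
      simp only [allTabs_mul, Bool.and_eq_true] at he
      simp only [PX.eval, eval_congr h a he.1, eval_congr h b he.2]
  | .divN a n, he => by simp only [PX.eval, eval_congr h a he]
  | .emax a b, he => by
      simp only [allTabs_emax, Bool.and_eq_true] at he
      simp only [PX.eval, eval_congr h a he.1, eval_congr h b he.2]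
  | .emin a b, he => by
      simp only [allTabs_emin, Bool.and_eq_true] at he
      simp only [PX.eval, eval_congr h a he.1, eval_congr h b he.2]
  | .pow a n, he => by simp only [PX.eval, eval_congr h a he]
  | .oddComp a n, he => by simp only [PX.eval, eval_congr h a he]
  | .sumR lo hi f, he => by
      rw [allTabs_sumR, List.all_eq_true] at he
      simp only [PX.eval]
      exact Finset.sum_congr rfl fun j hj => eval_congr h (f j) (he j (mem_range'_of_mem_Icc hj))

/-- RELATIVE MONOTONICITY IN THE TABLES (real semantics): raising the tables on the keys READ by `e` (all valuations
`≥ 0`) raises its value — the table analogue of `PX.eval_mono_on`, and `PX.eval_mono_tab` without the hypothesis at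
unread keys. -/
theorem eval_mono_tabs_on {r : κ → Bool} {va : ι → ℝ} {vt vt' : κ → ℝ} (ha : ∀ i, 0 ≤ va i) (ht : ∀ k, 0 ≤ vt k)
    (ht' : ∀ k, 0 ≤ vt' k) (hle : ∀ k, r k = true → vt k ≤ vt' k) :
    ∀ e : PX ι κ, allTabs r e = true → PX.eval va vt e ≤ PX.eval va vt' e
  | .atom _, _ => le_rfl
  | .tab k, he => hle k he
  | .num _, _ => le_rfl
  | .add a b, he => by
      simp only [allTabs_add, Bool.and_eq_true] at he
      exact add_le_add (eval_mono_tabs_on ha ht ht' hle a he.1) (eval_mono_tabs_on ha ht ht' hle b he.2)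
  | .mul a b, he => by
      simp only [allTabs_mul, Bool.and_eq_true] at he
      exact mul_le_mul (eval_mono_tabs_on ha ht ht' hle a he.1) (eval_mono_tabs_on ha ht ht' hle b he.2)
        (PX.eval_nonneg ha ht b) (PX.eval_nonneg ha ht' a)
  | .divN a n, he => div_le_div_of_nonneg_right (eval_mono_tabs_on ha ht ht' hle a he) (Nat.cast_nonneg n)
  | .emax a b, he => by
      simp only [allTabs_emax, Bool.and_eq_true] at he
      exact max_le_max (eval_mono_tabs_on ha ht ht' hle a he.1) (eval_mono_tabs_on ha ht ht' hle b he.2)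
  | .emin a b, he => by
      simp only [allTabs_emin, Bool.and_eq_true] at he
      exact min_le_min (eval_mono_tabs_on ha ht ht' hle a he.1) (eval_mono_tabs_on ha ht ht' hle b he.2)
  | .pow a n, he => pow_le_pow_left₀ (PX.eval_nonneg ha ht a) (eval_mono_tabs_on ha ht ht' hle a he) n
  | .oddComp a n, he => by
      have h' := PX.odd_pow_mono n (sub_le_sub_left (eval_mono_tabs_on ha ht ht' hle a he) 1)
      show 1 - (1 - PX.eval va vt a) ^ (2 * n + 1) ≤ 1 - (1 - PX.eval va vt' a) ^ (2 * n + 1)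
      linarith
  | .sumR lo hi f, he => by
      rw [allTabs_sumR, List.all_eq_true] at he
      simp only [PX.eval]
      exact Finset.sum_le_sum fun j hj => eval_mono_tabs_on ha ht ht' hle (f j) (he j (mem_range'_of_mem_Icc hj))

end PXKeys

open Stage1Cells

/-- the Boolean test of the read set on table keys: `.saw j v` must satisfy `1 ≤ j ≤ 12 ∧ v ≠ v0` or `(j, v) = (13, v1)`;
keys of the other tables pass (this module is about the `nrSAW` column). -/
def sawKeyRead : TKey → Bool
  | .saw j v => (decide (1 ≤ j) && decide (j ≤ 12) && !decide (v = .v0)) || (decide (j = 13) && decide (v = .v1))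
  | _ => true

/-- the Boolean test agrees with membership in `sawReadKeys13`. -/
theorem sawKeyRead_saw_iff (j : ℕ) (v : V) : sawKeyRead (.saw j v) = true ↔ (j, v) ∈ sawReadKeys13 := by
  rw [mem_sawReadKeys13_iff]
  simp only [sawKeyRead, Bool.or_eq_true, Bool.and_eq_true, Bool.not_eq_true', decide_eq_true_eq,
    decide_eq_false_iff_not, ne_eq, and_assoc]

/-- apply a cell that may or may not depend on the parameters (Lean drops an unused section variable `P`). -/
class AtP (α : Type) where
  /-- the cell at `P` -/
  app : α → Params → T
/-- a parameter-free scalar cell. -/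
instance : AtP T := ⟨fun t _ => t⟩
/-- a parametrised scalar cell. -/
instance : AtP (Params → T) := ⟨fun f P => f P⟩
/-- idem, vector-valued cells. -/
class AtPV (α : Type) where
  /-- the cell at `P` -/
  app : α → Params → Vec
/-- a parameter-free vector cell. -/
instance : AtPV Vec := ⟨fun t _ => t⟩
/-- a parametrised vector cell. -/
instance : AtPV (Params → Vec) := ⟨fun f P => f P⟩
/-- idem, matrix-valued cells. -/
class AtPM (α : Type) where
  /-- the cell at `P` -/
  app : α → Params → Mat
/-- a parameter-free matrix cell. -/
instance : AtPM Mat := ⟨fun t _ => t⟩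
/-- a parametrised matrix cell. -/
instance : AtPM (Params → Mat) := ⟨fun f P => f P⟩

/-- the three entries of a vector cell. -/
def vecL (u : Vec) : List T := [u 0, u 1, u 2]
/-- the nine entries of a matrix cell. -/
def matL (M : Mat) : List T := [M 0 0, M 0 1, M 0 2, M 1 0, M 1 1, M 1 2, M 2 0, M 2 1, M 2 2]

end Summit.CriticalPhenomena.LaceExpansionHighD
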